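/-
Origin: expansion seat `planner-pub-hodgecm-pv06-g6-0`, handover #2 v3 (DOC-ONLY: O14-R locator named, referee adv2-g36 X68; SUPERSEDES v2 b12b3920 in place 2026-08-18T13:47:10Z, itself superseding 0f6f71a6; code residue 9e326996 identical v1=v2=v3; HANDOVER #2 13:07:16Z) md5 e92906df66cef04a0f8811932ecf8128 (715 l.); imports `Pv06g6.ArchCOrbit` (ONE rewrite -> `HodgeCM.PerL34.ArchCOrbit`, generic ^import Pv[0-9]+g[0-9]+\. rule; as-landed md5 27adb253466b01f741 (`HOME/pub-hodgecm-pv06-g6/lean/Pv06g6/ArchCOrbitSmooth.lean`, md5 e92906df, 715 lines);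
landed by the gen-8 packager in gate run 30 as `HodgeCM/PerL34/ArchCOrbitSmooth.lean` (import ^import Pv06g6\.ArchCOrbit[ \t]*$→import HodgeCM.PerL34.ArchCOrbit ×1).
-/
/-
  HodgeCM/PerL34/ArchCOrbitSmooth.lean   (origin: pub-hodgecm-pv06-g6, WIP module `Pv06g6.ArchCOrbitSmooth`;
  session planner-pub-hodgecm-pv06-g6-0; v3 = DOC-ONLY update (O14-R locator named, referee adv2-g35 O14-R / adv2-g36 X68; code unchanged), DAG-NODE PROVER #06 gen 6; intended final place
  `HodgeCM/PerL34/ArchCOrbitSmooth.lean`, module `HodgeCM.PerL34.ArchCOrbitSmooth`; ONE import rewrite at intake: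
  `import Pv06g6.ArchCOrbit` ↦ `import HodgeCM.PerL34.ArchCOrbit` (this seat's RUN-30 row #1, f4521912…).)

  # Lemma 4.1(c): the last analytic input as a statement about ω ALONE — Fock vectors are FRÉCHET-smooth vectors of ω

  NODE N29 (= [PerL] v5 Lemma 4.1(c), ll. 488–490 / 513–523; seam S4), continued from `ArchCOrbit.lean`.  KIND: KERNEL.
  Nothing is cited, nothing is posited; complete proofs; standard axioms.

  After `ArchCOrbit.lean` the only analytic input of L4.1(c) is the field `hF` of the bridge records ([SETUP D5]):
      s ↦ 𝒯_{ω(e_j s)(φ⊗Φ_f)}(·)(p)  has derivative  𝒯_{(X_jφ)⊗Φ_f}(·)(p)  at s = 0, IN OPERATOR NORM on (L²)*.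
  That statement still mixes a smooth-vector fact about ω ALONE (Schwartz/Fock vectors are C^∞ vectors of the oscillator
  representation — in the FRÉCHET sense needed here: Poulsen 1972 Prop. 1.2, see `FockSmoothBridge.smooth`; Folland 1989
  Thm. (4.45) / Prop. (4.49) give the L² sense and the value of dω) with the operator 𝒯.  This file separates them:
  * the orbit argument needs the derivative only SCALARWISE — for each fixed v ∈ σ̂_i the scalar function
    s ↦ 𝒯_{ω(e_j s)(φ⊗Φ_f)}(v)(p) (§1 `vanish_of_hasDerivAt_scalar`, `orbit_stable_of_hasDerivAt_scalar`,
    `orbit_stable_of_realDirections_scalar`); the scalar form is implied by `hF` (§0 `hasDerivAt_clm_apply`);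
  * the scalar form follows — KERNEL, §0 `hasDerivAt_clm_comp_of_tendsto_slope` (Mathlib only) and §1
    `hasDerivAt_pointValue_of_tendsto_slope` — from the ω-side smooth-vector statement with NO 𝒯 in it:
        the difference quotients s⁻¹(ω(e_j s)Φ − ω(e_j 0)Φ) converge to (X_jφ)⊗Φ_f IN THE TOPOLOGY OF 𝒮^κ  (`smooth`),
    i.e. φ⊗Φ_f is a C¹-vector of ω along e_j with derivative (X_jφ)⊗Φ_f in the Schwartz topology, composed with the
    continuous linear functional Φ ↦ 𝒯_Φ(v)(p) ([SETUP D4] `TΦc_add`, `TΦc_smul`, `cont` — fields the records already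
    carry; pv05-g2 `evalFunctional`).
  §2 records: `FockScalarBridge C D P` (= `FockOrbitBridge` with `hF` replaced by the scalar `hFpt`; the WEAKEST typed
  analytic S4 input), `FockSmoothBridge C D P` (= `FockOrbitBridge` with `hF` replaced by the ω-side `smooth`; the
  Fréchet-smooth-vector form [SETUP D5′]); maps `FockScalarBridge.ofOrbit`, `FockSmoothBridge.toScalarBridge`, `toOrbitCore`, `H_occ`;
  printed-places siblings `PrintedScalarSide`, `PrintedSmoothSide`; §3 model level `Open_occ_of_fockScalarBridges`,
  `Open_occ_of_fockSmoothBridges`, `N29_occ_of_fockSmoothBridges`.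
  LATTICE OF S4 INPUTS (each arrow a kernel map in the tree / this seat's two files; all end in `OccLeaf` / `Open_occ`):
      ArchCDatum ─toCore→ ArchCCore ─toOrbitCore→ OrbitCore ←toOrbitCore─ FockOrbitBridge ←ofAnalytic─ FockAnalyticBridge
      FockOrbitBridge ─ofOrbit→ FockScalarBridge ←toScalarBridge─ FockSmoothBridge ;  FockScalarBridge ─toOrbitCore→ OrbitCore.
  LABELS: [NODE N21] `invariance`; [NODE N28] `gen`/`φ₀_eigen` (kernel, pv12); [SETUP D4] linearity/continuity/density/
  `omg_ins`/`ιT`; [SETUP D5] `XR`, `e`, `ladder_span`; [SETUP D5′] `smooth` = Fréchet-smooth vector, ω-side (print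
  warrant: Poulsen 1972, J. Funct. Anal. 9, Prop. 1.2 + Thm. 1.2, p. 93 [held copy p0007 L35–37 / L12–20], PLUS the
  identification of D_∞(ω_∞) and its Fréchet topology on 𝒮 with the Schwartz space/topology — (D_∞(μ|Mp), Goodman) = (𝒮, Schwartz) by Folland 1989 p. 165 ((4.47), dμ(𝒥) = πi(D²+X²)) + Reed–Simon I App. to V.3 Lemmas 1–2 / Thm. V.13 (pp. 141–143) + Folland Thm. (4.45), locator NAMED by referee adv2-g35 O14-R (GAPS l. 9152), independently GAPS pv12g8-1; Folland 1989 Thm. (4.45) [p0163 L41–43] / Prop. (4.49) [p0166 L34] give C^∞-ness in the L²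
  sense and the VALUE of dω(X) only) resp. its scalar shadow `hFpt` [SETUP D5, scalar]; [DEFINITIONAL]
  `wOccurs_of_eigenvector`.  ABSOLUTE RULE kept (nothing cited enters Lean; the labels name the warrant a discharger
  must quote).
-/
import Summits.HodgeConjecture.HodgeCM.PerL34.ArchCOrbit_3
import Mathlib.Analysis.Calculus.Deriv.Slope

set_option autoImplicit false

noncomputable section

open scoped Topology
open Filter

namespace HodgeCM
namespace PerL34
namespace ArchC

open HodgeCM.Prior.Perl34File HodgeCM.Prior.Perl34File.Perl34

/-! ## §0  Two Mathlib-only calculus lemmas -/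

section Calculus

/-- A curve of bounded functionals differentiable in operator norm is differentiable on each vector. -/
theorem hasDerivAt_clm_apply {E : Type*} [NormedAddCommGroup E] [NormedSpace ℂ E]
    {L : ℝ → E →L[ℂ] ℂ} {L' : E →L[ℂ] ℂ} {s₀ : ℝ} (hL : HasDerivAt L L' s₀) (v : E) :
    HasDerivAt (fun s => L s v) (L' v) s₀ := by
  have hc := (((ContinuousLinearMap.apply ℂ ℂ v).restrictScalars ℝ).hasFDerivAt).comp_hasDerivAt s₀ hL
  simpa only [Function.comp_def, ContinuousLinearMap.coe_restrictScalars',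
    ContinuousLinearMap.apply_apply] using hc

/-- **Chain rule through a continuous linear functional on a topological vector space.**  If the difference quotients
(s − s₀)⁻¹ • (γ s − γ s₀) of a curve `γ` in a topological ℂ-module `S` (no norm — e.g. a Schwartz space) converge to `γ'`
as s → s₀, s ≠ s₀, then for every continuous linear functional `L` the scalar function `L ∘ γ` has derivative `L γ'` at
`s₀`.  (No compatibility of the topology of `S` with its linear structure is needed.) -/
theorem hasDerivAt_clm_comp_of_tendsto_slope {S : Type*} [TopologicalSpace S] [AddCommGroup S] [Module ℂ S]
    (L : S →L[ℂ] ℂ) {γ : ℝ → S} {γ' : S} {s₀ : ℝ}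
    (h : Tendsto (fun s : ℝ => ((s - s₀ : ℝ) : ℂ)⁻¹ • (γ s - γ s₀)) (𝓝[≠] s₀) (𝓝 γ')) :
    HasDerivAt (fun s => L (γ s)) (L γ') s₀ := by
  rw [hasDerivAt_iff_tendsto_slope]
  have h2 : Tendsto (fun s : ℝ => L (((s - s₀ : ℝ) : ℂ)⁻¹ • (γ s - γ s₀))) (𝓝[≠] s₀) (𝓝 (L γ')) :=
    (L.continuous.tendsto γ').comp h
  refine h2.congr' (Eventually.of_forall fun s => ?_)
  rw [slope_def_module, map_smul, map_sub, smul_eq_mul, Complex.real_smul, Complex.ofReal_inv]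

/-- The same at `s₀ = 0`, with the difference quotient written `s⁻¹ • (γ s − γ 0)`. -/
theorem hasDerivAt_clm_comp_of_tendsto_slope_zero {S : Type*} [TopologicalSpace S] [AddCommGroup S] [Module ℂ S]
    (L : S →L[ℂ] ℂ) {γ : ℝ → S} {γ' : S}
    (h : Tendsto (fun s : ℝ => ((s : ℝ) : ℂ)⁻¹ • (γ s - γ 0)) (𝓝[≠] 0) (𝓝 γ')) :
    HasDerivAt (fun s => L (γ s)) (L γ') 0 :=
  hasDerivAt_clm_comp_of_tendsto_slope L (by simpa only [sub_zero] using h)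

end Calculus

/-! ## §1  The scalar orbit lemma over the frozen interface -/

section Orbit

variable {H HG CG G SK SigIdx SigIdxG : Type*}
variable [NormedAddCommGroup H] [InnerProductSpace ℂ H] [CompleteSpace H]
variable [NormedAddCommGroup HG] [InnerProductSpace ℂ HG] [CompleteSpace HG]
variable [NormedAddCommGroup CG] [NormedSpace ℂ CG]
variable [Group G] [TopologicalSpace G] [TopologicalSpace SK]
variable {C : IsolationCore H HG CG G SK SigIdx SigIdxG} {P : C4a.PointedCore C}

/-- **Differentiating the zero function along an orbit, scalarwise.**  If for each v ∈ σ̂_i the SCALAR function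
s ↦ 𝒯_{ω(e s)Φ}(v)(p) has derivative 𝒯_Ψ(v)(p) at 0, and the whole family annihilates σ̂_i at p, then so does Ψ.
KERNEL: uniqueness of derivatives (`HasDerivAt.unique`, `hasDerivAt_const`). -/
theorem vanish_of_hasDerivAt_scalar {Φ Ψ : SK} {p : P.Pt} {i : SigIdx} (e : ℝ → G)
    (hd : ∀ v ∈ C.hatσ i, HasDerivAt (fun s : ℝ => P.evalPt p (C.TΦc (C.omg (e s) Φ) v))
      (P.evalPt p (C.TΦc Ψ v)) 0)
    (h : ∀ s : ℝ, ∀ v ∈ C.hatσ i, P.evalPt p (C.TΦc (C.omg (e s) Φ) v) = 0) :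
    ∀ v ∈ C.hatσ i, P.evalPt p (C.TΦc Ψ v) = 0 := fun v hv => by
  have h₁ := hd v hv
  have hc : (fun s : ℝ => P.evalPt p (C.TΦc (C.omg (e s) Φ) v)) = fun _ => (0 : ℂ) := funext fun s => h s v hv
  rw [hc] at h₁
  exact h₁.unique (hasDerivAt_const 0 (0 : ℂ))

/-- The operator-norm derivative ([SETUP D5] `hF` of `FockOrbitBridge`) gives the scalar one. -/
theorem hasDerivAt_pointValue_of_hasDerivAt {Φ Ψ : SK} {p : P.Pt} (e : ℝ → G)
    (hd : HasDerivAt (fun s : ℝ => C4a.pointFunctional C P (C.omg (e s) Φ) p)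
      (C4a.pointFunctional C P Ψ p) 0) (v : H) :
    HasDerivAt (fun s : ℝ => P.evalPt p (C.TΦc (C.omg (e s) Φ) v)) (P.evalPt p (C.TΦc Ψ v)) 0 :=
  hasDerivAt_clm_apply hd v

/-- **The scalar derivative from the PRINTED smooth-vector statement.**  If the difference quotients
s⁻¹(γ s − γ 0) of a curve `γ` in 𝒮^κ converge in the topology of 𝒮^κ to `γ'` (γ 0 is a C¹ vector along γ), then for
every g and v the scalar s ↦ 𝒯_{γ s}(v)(g) has derivative 𝒯_{γ'}(v)(g) at 0 — through the bounded linear functional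
Φ ↦ 𝒯_Φ(v)(g) ([SETUP D4] `TΦc_add`, `TΦc_smul`, `cont`; pv05-g2 `evalFunctional`). -/
theorem hasDerivAt_pointValue_of_tendsto_slope [AddCommGroup SK] [Module ℂ SK]
    (TΦc_add : ∀ Φ Ψ : SK, C.TΦc (Φ + Ψ) = C.TΦc Φ + C.TΦc Ψ)
    (TΦc_smul : ∀ (c : ℂ) (Φ : SK), C.TΦc (c • Φ) = c • C.TΦc Φ)
    (cont : ∀ (p : P.Pt) (v : H), Continuous fun Φ : SK => P.evalPt p (C.TΦc Φ v))
    {γ : ℝ → SK} {γ' : SK}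
    (h : Tendsto (fun s : ℝ => ((s : ℝ) : ℂ)⁻¹ • (γ s - γ 0)) (𝓝[≠] 0) (𝓝 γ')) (p : P.Pt) (v : H) :
    HasDerivAt (fun s : ℝ => P.evalPt p (C.TΦc (γ s) v)) (P.evalPt p (C.TΦc γ' v)) 0 :=
  hasDerivAt_clm_comp_of_tendsto_slope_zero (evalFunctional TΦc_add TΦc_smul p v (cont p v)) h

/-- **`orbit_stable` DISCHARGED from the scalar derivative along a family of curves** (the scalar sibling of
`orbit_stable_of_hasDerivAt`). -/
theorem orbit_stable_of_hasDerivAt_scalar {F FinIdx ιR : Type*} (ins : FinIdx → F → SK) (XR : ιR → F → F)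
    (e : ιR → ℝ → G)
    (hFpt : ∀ (j : ιR) (f : FinIdx) (φ : F) (p : P.Pt) (v : H),
      HasDerivAt (fun s : ℝ => P.evalPt p (C.TΦc (C.omg (e j s) (ins f φ)) v))
        (P.evalPt p (C.TΦc (ins f (XR j φ)) v)) 0) :
    ∀ (j : ιR) (f : FinIdx) (p : P.Pt) (i : SigIdx) (φ : F),
      (∀ g : G, ∀ v ∈ C.hatσ i, P.evalPt p (C.TΦc (C.omg g (ins f φ)) v) = 0) →
        ∀ v ∈ C.hatσ i, P.evalPt p (C.TΦc (ins f (XR j φ)) v) = 0 :=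
  fun j f p _ φ horb =>
    vanish_of_hasDerivAt_scalar (e j) (fun v _ => hFpt j f φ p v) fun s => horb (e j s)

/-- **`orbit_stable` DISCHARGED, scalar form, for any family in the ℂ-span of the real directions** (the scalar
sibling of `orbit_stable_of_realDirections`: annihilator submodule + `Fock.stable_of_mem_span`). -/
theorem orbit_stable_of_realDirections_scalar
    (invariance : ∀ (h : G) (Φ : SK) (v : H), C.TΦc (C.omg h Φ) (C.R h v) = C.TΦc Φ v)
    {F FinIdx : Type*} [AddCommGroup F] [Module ℂ F] (ins : FinIdx → F → SK)
    (ins_add : ∀ (f : FinIdx) (φ ψ : F), C.TΦc (ins f (φ + ψ)) = C.TΦc (ins f φ) + C.TΦc (ins f ψ))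
    (ins_smul : ∀ (f : FinIdx) (c : ℂ) (φ : F), C.TΦc (ins f (c • φ)) = c • C.TΦc (ins f φ))
    {ιR : Type*} (XR : ιR → F →ₗ[ℂ] F) (e : ιR → ℝ → G)
    (hFpt : ∀ (j : ιR) (f : FinIdx) (φ : F) (p : P.Pt) (v : H),
      HasDerivAt (fun s : ℝ => P.evalPt p (C.TΦc (C.omg (e j s) (ins f φ)) v))
        (P.evalPt p (C.TΦc (ins f (XR j φ)) v)) 0)
    {ιX : Type*} (X : ιX → F →ₗ[ℂ] F) (hX : ∀ k, X k ∈ Submodule.span ℂ (Set.range XR)) :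
    ∀ (k : ιX) (f : FinIdx) (p : P.Pt) (i : SigIdx) (φ : F),
      (∀ g : G, ∀ v ∈ C.hatσ i, P.evalPt p (C.TΦc (C.omg g (ins f φ)) v) = 0) →
        ∀ v ∈ C.hatσ i, P.evalPt p (C.TΦc (ins f (X k φ)) v) = 0 := by
  intro k f p i φ horb
  let N : Submodule ℂ F := annihilatorIn (insPairing ins ins_add ins_smul f p) (C.hatσ i : Set H)
  have hN : ∀ j, ∀ ψ ∈ N, XR j ψ ∈ N := fun j ψ hψ =>
    orbit_stable_of_hasDerivAt_scalar ins (fun j φ => XR j φ) e hFpt j f p i ψ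
      (vanish_omg_of_vanish invariance ((mem_annihilatorIn _ _ _).mp hψ))
  have hφ : φ ∈ N := fun v hv => by
    have h := horb 1 v hv
    rwa [TΦc_omg_apply invariance, inv_one, map_one, one_apply_eq_self] at h
  exact Fock.stable_of_mem_span XR N hN (hX k) φ hφ

end Orbit

/-! ## §2  Records: the scalar and the Fréchet-smooth S4 inputs -/

section Bridge

open HodgeCM.PerL34.Fock HodgeCM.PerL34.Fock.PrintDict

variable {H HG CG G SK SigIdx SigIdxG : Type*}
variable [NormedAddCommGroup H] [InnerProductSpace ℂ H] [CompleteSpace H]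
variable [NormedAddCommGroup HG] [InnerProductSpace ℂ HG] [CompleteSpace HG]
variable [NormedAddCommGroup CG] [NormedSpace ℂ CG]
variable [Group G] [TopologicalSpace G] [TopologicalSpace SK]

/-- **Seam S4 bridge, scalar form** = `FockOrbitBridge C D P` with the operator-norm field `hF` replaced by its scalar
shadow `hFpt` — the WEAKEST typed analytic input from which the orbit argument runs; every other field verbatim. -/
structure FockScalarBridge (C : IsolationCore H HG CG G SK SigIdx SigIdxG) (D : TorusData C)
    (P : C4a.PointedCore C) where
  /-- [SETUP D5 + NODE N28 local (kernel)] the real places with their κ_b-parts. -/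
  pl : Fock.FockPlaces
  /-- [SETUP D4] T(L₀⊗ℝ) ⊂ U(W)(𝔸) = `G`. -/
  ιT : pl.Tg →* G
  /-- [SETUP D4] the archimedean type w as a character of T(L₀⊗ℝ). -/
  w : pl.Tg →* ℂ
  /-- [SETUP D4] w is unitary. -/
  w_norm : ∀ t, ‖w t‖ = 1
  /-- [NODE N26 / DICTIONARY] the joint vacuum character IS w⁻¹. -/
  w_loc : ∀ t : pl.Tg, pl.χ t = (w t)⁻¹
  /-- [SETUP D4] the additive group structure of 𝒮^κ. -/
  [instSKacg : AddCommGroup SK]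
  /-- [SETUP D4] the ℂ-vector-space structure of 𝒮^κ. -/
  [instSKmod : Module ℂ SK]
  /-- [SETUP D4] Φ ↦ 𝒯_Φ is additive. -/
  TΦc_add : ∀ Φ Ψ : SK, C.TΦc (Φ + Ψ) = C.TΦc Φ + C.TΦc Ψ
  /-- [SETUP D4] Φ ↦ 𝒯_Φ is homogeneous. -/
  TΦc_smul : ∀ (c : ℂ) (Φ : SK), C.TΦc (c • Φ) = c • C.TΦc Φ
  /-- [SETUP D4] Φ ↦ 𝒯_Φ(v)(g) is continuous on 𝒮^κ. -/
  cont : ∀ (p : P.Pt) (v : H), Continuous fun Φ : SK => P.evalPt p (C.TΦc Φ v)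
  /-- [SETUP D4] index of the fixed finite data Φ_f. -/
  FinIdx : Type
  /-- [SETUP D4] φ ↦ φ ⊗ Φ_f, linear. -/
  ins : FinIdx → pl.F →ₗ[ℂ] SK
  /-- [SETUP D4/D5] the pure tensors span a dense subspace of 𝒮^κ. -/
  dense : Dense (Submodule.span ℂ (Set.range fun q : FinIdx × pl.F => ins q.1 q.2) : Set SK)
  /-- [SETUP D4] ω(t)(φ ⊗ Φ_f) = (ω_∞(t)φ) ⊗ Φ_f. -/
  omg_ins : ∀ (f : FinIdx) (t : pl.Tg) (φ : pl.F), C.omg (ιT t) (ins f φ) = ins f (pl.ωT t φ)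
  /-- [NODE N21] 𝒯_{ω(h)Φ}(R(h)v) = 𝒯_Φ(v). -/
  invariance : ∀ (h : G) (Φ : SK) (v : H), C.TΦc (C.omg h Φ) (C.R h v) = C.TΦc Φ v
  /-- [SETUP D5] index of a family of real directions X_j ∈ 𝔲(W)(L₀⊗ℝ). -/
  ιR : Type
  /-- [SETUP D5] ω_∞(X_j) on 𝓕^κ_∞. -/
  XR : ιR → pl.F →ₗ[ℂ] pl.F
  /-- [SETUP D4] the curves e_j : ℝ → U(W)(𝔸) (intended exp(sX_j); only behaviour at s → 0 is consumed). -/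
  e : ιR → ℝ → G
  /-- [SETUP D5] ladder operators are complex combinations of the real directions. -/
  ladder_span : ∀ k : pl.ιX, pl.X k ∈ Submodule.span ℂ (Set.range XR)
  /-- [SETUP D5, scalar shadow] for every g and v, the SCALAR function s ↦ 𝒯_{ω(e_j s)(φ⊗Φ_f)}(v)(g) has derivative
  𝒯_{(X_jφ)⊗Φ_f}(v)(g) at s = 0.  Implied by `FockOrbitBridge.hF` (`ofOrbit`) and by the printed smooth-vector
  statement `FockSmoothBridge.smooth` (`FockSmoothBridge.toScalarBridge`), both KERNEL. -/
  hFpt : ∀ (j : ιR) (f : FinIdx) (φ : pl.F) (p : P.Pt) (v : H),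
    HasDerivAt (fun s : ℝ => P.evalPt p (C.TΦc (C.omg (e j s) (ins f φ)) v))
      (P.evalPt p (C.TΦc (ins f (XR j φ)) v)) 0
  /-- [DEFINITIONAL] the meaning of the bare frozen predicate `TorusData.wOccurs`. -/
  wOccurs_of_eigenvector : ∀ i : SigIdx,
    (∃ y ∈ C.hatσ i, y ≠ 0 ∧ ∀ t : pl.Tg, C.R (ιT t) y = w t • y) → D.wOccurs i

namespace FockScalarBridge

variable {C : IsolationCore H HG CG G SK SigIdx SigIdxG} {D : TorusData C} {P : C4a.PointedCore C}

/-- **The D7-free chart from the scalar bridge** (`orbit_stable` by `orbit_stable_of_hasDerivAt_scalar`; the rest as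
`FockOrbitBridge.toOrbitCore`). -/
def toOrbitCore (B : FockScalarBridge C D P) : OrbitCore C P :=
  letI : AddCommGroup SK := B.instSKacg
  letI : Module ℂ SK := B.instSKmod
  { F := B.pl.F
    ιX := B.ιR
    X := B.XR
    Tg := B.pl.Tg
    ιT := B.ιT
    w := B.w
    w_norm := B.w_norm
    ωT := B.pl.ωT
    FinIdx := B.FinIdx
    ins := fun f φ => B.ins f φ
    φ₀ := B.pl.φ₀
    ins_add := fun f φ ψ => by
      show C.TΦc (B.ins f (φ + ψ)) = C.TΦc (B.ins f φ) + C.TΦc (B.ins f ψ)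
      rw [map_add, B.TΦc_add]
    ins_smul := fun f c φ => by
      show C.TΦc (B.ins f (c • φ)) = c • C.TΦc (B.ins f φ)
      rw [LinearMap.map_smul, B.TΦc_smul]
    omg_ins := B.omg_ins
    invariance := B.invariance
    pure_detect := pure_detect_of_dense B.TΦc_add B.TΦc_smul B.cont (fun f φ => B.ins f φ) B.dense
    orbit_stable := orbit_stable_of_hasDerivAt_scalar (fun f φ => B.ins f φ) (fun j φ => B.XR j φ) B.e B.hFpt
    gen := B.pl.gen_format_of_mem_span B.XR B.ladder_span
    φ₀_eigen := fun t => by rw [B.pl.ωT_φ₀, B.w_loc] }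

/-- (Ported verbatim from the HodgeCMPerL package; no docstring in the source.) -/
theorem toOrbitCore_F (B : FockScalarBridge C D P) : B.toOrbitCore.F = B.pl.F := rfl

/-- (Ported verbatim from the HodgeCMPerL package; no docstring in the source.) -/
theorem toOrbitCore_φ₀ (B : FockScalarBridge C D P) : B.toOrbitCore.φ₀ = B.pl.φ₀ := rfl

/-- (Ported verbatim from the HodgeCMPerL package; no docstring in the source.) -/
theorem toOrbitCore_eigen_iff (B : FockScalarBridge C D P) (i : SigIdx) :
    B.toOrbitCore.Eigen i ↔ ∃ y ∈ C.hatσ i, y ≠ 0 ∧ ∀ t : B.pl.Tg, C.R (B.ιT t) y = B.w t • y := Iff.rfl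

/-- **Lemma 4.1(c) over the scalar bridge.** -/
theorem H_occ (B : FockScalarBridge C D P) :
    ∀ (Φ : SK) (i : SigIdx), (∃ v ∈ C.hatσ i, C.TΦ Φ v ≠ 0) → D.wOccurs i :=
  B.toOrbitCore.occLeaf D B.wOccurs_of_eigenvector

/-- **Operator-norm bridge ⇒ scalar bridge** (`hFpt` from `hF` by `hasDerivAt_pointValue_of_hasDerivAt`). -/
def ofOrbit (B : FockOrbitBridge C D P) : FockScalarBridge C D P where
  pl := B.pl
  ιT := B.ιT
  w := B.w
  w_norm := B.w_norm
  w_loc := B.w_loc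
  instSKacg := B.instSKacg
  instSKmod := B.instSKmod
  TΦc_add := B.TΦc_add
  TΦc_smul := B.TΦc_smul
  cont := B.cont
  FinIdx := B.FinIdx
  ins := B.ins
  dense := B.dense
  omg_ins := B.omg_ins
  invariance := B.invariance
  ιR := B.ιR
  XR := B.XR
  e := B.e
  ladder_span := B.ladder_span
  hFpt := fun j f φ p v => hasDerivAt_pointValue_of_hasDerivAt (B.e j) (B.hF j f φ p) v
  wOccurs_of_eigenvector := B.wOccurs_of_eigenvector

/-- (Ported verbatim from the HodgeCMPerL package; no docstring in the source.) -/
theorem ofOrbit_pl (B : FockOrbitBridge C D P) : (ofOrbit B).pl = B.pl ∧ (ofOrbit B).w = B.w := ⟨rfl, rfl⟩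

end FockScalarBridge

/-- **Seam S4 bridge, FRÉCHET-SMOOTH form** = `FockOrbitBridge C D P` with the operator-norm field `hF` replaced by the
ω-side statement `smooth` ([SETUP D5′]: φ⊗Φ_f is a C¹ vector of ω in the topology of 𝒮^κ — Poulsen 1972 Prop. 1.2 +
Thm. 1.2 p. 93 plus the identification of the D_∞-topology on 𝒮 with the Schwartz topology — locator in the field
docstring), with NO 𝒯 in it. -/
structure FockSmoothBridge (C : IsolationCore H HG CG G SK SigIdx SigIdxG) (D : TorusData C)
    (P : C4a.PointedCore C) where
  /-- [SETUP D5 + NODE N28 local (kernel)] the real places with their κ_b-parts. -/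
  pl : Fock.FockPlaces
  /-- [SETUP D4] T(L₀⊗ℝ) ⊂ U(W)(𝔸) = `G`. -/
  ιT : pl.Tg →* G
  /-- [SETUP D4] the archimedean type w as a character of T(L₀⊗ℝ). -/
  w : pl.Tg →* ℂ
  /-- [SETUP D4] w is unitary. -/
  w_norm : ∀ t, ‖w t‖ = 1
  /-- [NODE N26 / DICTIONARY] the joint vacuum character IS w⁻¹. -/
  w_loc : ∀ t : pl.Tg, pl.χ t = (w t)⁻¹
  /-- [SETUP D4] the additive group structure of 𝒮^κ. -/
  [instSKacg : AddCommGroup SK]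
  /-- [SETUP D4] the ℂ-vector-space structure of 𝒮^κ. -/
  [instSKmod : Module ℂ SK]
  /-- [SETUP D4] Φ ↦ 𝒯_Φ is additive. -/
  TΦc_add : ∀ Φ Ψ : SK, C.TΦc (Φ + Ψ) = C.TΦc Φ + C.TΦc Ψ
  /-- [SETUP D4] Φ ↦ 𝒯_Φ is homogeneous. -/
  TΦc_smul : ∀ (c : ℂ) (Φ : SK), C.TΦc (c • Φ) = c • C.TΦc Φ
  /-- [SETUP D4] Φ ↦ 𝒯_Φ(v)(g) is continuous on 𝒮^κ. -/
  cont : ∀ (p : P.Pt) (v : H), Continuous fun Φ : SK => P.evalPt p (C.TΦc Φ v)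
  /-- [SETUP D4] index of the fixed finite data Φ_f. -/
  FinIdx : Type
  /-- [SETUP D4] φ ↦ φ ⊗ Φ_f, linear. -/
  ins : FinIdx → pl.F →ₗ[ℂ] SK
  /-- [SETUP D4/D5] the pure tensors span a dense subspace of 𝒮^κ. -/
  dense : Dense (Submodule.span ℂ (Set.range fun q : FinIdx × pl.F => ins q.1 q.2) : Set SK)
  /-- [SETUP D4] ω(t)(φ ⊗ Φ_f) = (ω_∞(t)φ) ⊗ Φ_f. -/
  omg_ins : ∀ (f : FinIdx) (t : pl.Tg) (φ : pl.F), C.omg (ιT t) (ins f φ) = ins f (pl.ωT t φ)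
  /-- [NODE N21] 𝒯_{ω(h)Φ}(R(h)v) = 𝒯_Φ(v). -/
  invariance : ∀ (h : G) (Φ : SK) (v : H), C.TΦc (C.omg h Φ) (C.R h v) = C.TΦc Φ v
  /-- [SETUP D5] index of a family of real directions X_j ∈ 𝔲(W)(L₀⊗ℝ). -/
  ιR : Type
  /-- [SETUP D5] ω_∞(X_j) on 𝓕^κ_∞. -/
  XR : ιR → pl.F →ₗ[ℂ] pl.F
  /-- [SETUP D4] the curves e_j : ℝ → U(W)(𝔸) (intended exp(sX_j)). -/
  e : ιR → ℝ → G
  /-- [SETUP D5] ladder operators are complex combinations of the real directions. -/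
  ladder_span : ∀ k : pl.ιX, pl.X k ∈ Submodule.span ℂ (Set.range XR)
  /-- [SETUP D5′, FRÉCHET-SMOOTH VECTOR — a statement about ω alone: no 𝒯, no L²] φ⊗Φ_f is a C¹ vector of ω along e_j
  with derivative (X_jφ)⊗Φ_f IN THE TOPOLOGY OF 𝒮^κ (the SAME `[TopologicalSpace SK]` that carries `cont`): the
  difference quotients s⁻¹(ω(e_j s)(φ⊗Φ_f) − ω(e_j 0)(φ⊗Φ_f)) converge to (X_jφ)⊗Φ_f as s → 0, s ≠ 0.
  PRINT WARRANT (referee adv2-g34 O14, 2026-08-18): Poulsen 1972 (J. Funct. Anal. 9, doi:10.1016/0022-1236(72)90016-x)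
  Prop. 1.2, p. 93 [held copy p0007 L35–37]: "For each x ∈ D_∞, the mapping g → V_∞(g)x is C^∞ from G to D_∞" (D_∞ with
  its Fréchet topology; ibid. Thm. 1.2, p. 93 (Goodman): that topology is the one of the seminorms x ↦ ‖Aⁿx‖, A = dV(L)‾,
  L elliptic), TOGETHER WITH the identification, on 𝒮, of D_∞(ω_∞) and its Fréchet topology with the Schwartz space and
  topology — PRINT LOCATOR (referee adv2-g35 O14-R, GAPS l. 9152; independently GAPS pv12g8-1): Folland 1989 p. 165
  [held p0165 L3–9]: the infinitesimal metaplectic representation sends the elliptic element to dμ(𝒥) = πi(D²+X²) ((4.47)),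
  whose space of C^∞ vectors with the Goodman topology is 𝒮 with the Schwartz topology by Reed–Simon I, Appendix to §V.3,
  Lemmas 1–2 / Thm. V.13 (pp. 141–143) [held p0132–p0134] (the N-representation theorem) + Folland Thm. (4.45); so
  Poulsen Thm. 1.2 + Prop. 1.2 give the orbit map C^∞ into (𝒮, Schwartz).  Folland 1989 Thm. (4.45) [held copy p0163 L41–43] / Prop. (4.49)
  [p0166 L34] warrant only that 𝒮 consists of C^∞ vectors in the L² sense (difference quotients in the L² NORM, p0163
  L39) and the VALUE dω(X) = the explicit differential operators; the clause typed here is STRONGER (Schwartz-topology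
  convergence) and is exactly what composition with `cont` requires.  At discharge cite Poulsen + the identification
  chain above, not (4.45) alone. -/
  smooth : ∀ (j : ιR) (f : FinIdx) (φ : pl.F),
    Tendsto (fun s : ℝ => ((s : ℝ) : ℂ)⁻¹ • (C.omg (e j s) (ins f φ) - C.omg (e j 0) (ins f φ)))
      (𝓝[≠] 0) (𝓝 (ins f (XR j φ)))
  /-- [DEFINITIONAL] the meaning of the bare frozen predicate `TorusData.wOccurs`. -/
  wOccurs_of_eigenvector : ∀ i : SigIdx,
    (∃ y ∈ C.hatσ i, y ≠ 0 ∧ ∀ t : pl.Tg, C.R (ιT t) y = w t • y) → D.wOccurs i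

namespace FockSmoothBridge


-- port_pkg: scope closed for this part
end FockSmoothBridge
end Bridge
end ArchC
end PerL34
end HodgeCM
end
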